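import Literature.AnabelianGeometry.SemiGraphs.FiniteEtaleCoveringComp
import HarnessLib

/-!
# Composites of finite étale coverings: the global clause with an EXPLICIT base object, and its
# invariance under isomorphism of the base object ([SemiAnbd] §2, Def. 2.2 (i) p. 23)

Mochizuki, *Semi-graphs of anabelioids*, Publ. RIMS **42** (2006) 221–322, §2, Definition 2.2 (i)
p. 23 ("`B' = B(𝒢)_{G'}` … arises naturally as the `B(−)` of some … `𝒢'`").
[cite: MochizukiSemiAnbd2006, Def. 2.2(i) p.23]

PROOF-ONLY sequel to `FiniteEtaleCoveringComp.lean` (abc-iut cell, F wave, FACT-LIST row F-1478, seat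
abc-iut-f-161), written for the ASSEMBLY of "print's finite étale coverings compose" (the four clauses
of `Hom.IsFiniteEtaleCoveringGlobal` must hold for ONE AND THE SAME object of `B(𝒦)`):

* `Hom.IsGlobalCoveringOf.comp_explicit` — the global clause of `φ.comp ψ` over the EXPLICIT object
  `C := (α⁻¹ B).left`, for any chosen global datum `(α, e)` of the second factor `ψ`
  (`ψ^* ≅ (A × −) ⋙ α`); this is the `C` over which the local clause of the composite is being built
  (abc-iut-w5-d041), so both clauses refer to the same object;
* `Hom.IsGlobalCoveringOf.of_iso` — the global clause is invariant under isomorphism of the base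
  object (`Over C ≌ Over C'` along `C ≅ C'`, compatibly with `(C × −)`, again by uniqueness of right
  adjoints: the left adjoints `forget C'` and `map i⁻¹ ⋙ forget C` are equal).

Nothing here takes a side on [IUTchIII] Cor. 3.12.
-/

namespace Literature.AnabelianGeometry.SemiGraphs

open CategoryTheory CategoryTheory.Limits

universe v₁ u₁ u

namespace SemiGraphOfAnabelioids

variable {𝒢 ℋ 𝒦 : SemiGraphOfAnabelioids.{v₁, u₁, u}}

/-- **The global clause of a composite over the explicit object `(α⁻¹ B).left`.**  If `φ : 𝒢 → ℋ`
satisfies the global clause over `B ∈ B(ℋ)` and `(α, e)` is a global datum for `ψ : ℋ → 𝒦` over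
`A ∈ B(𝒦)` (`α : B(𝒦)_{/A} ⥤ B(ℋ)` an equivalence with `ψ^* ≅ (A × −) ⋙ α`), then `φ.comp ψ` satisfies
the global clause over `C := (α⁻¹ B).left ∈ B(𝒦)` (same proof as `Hom.IsGlobalCoveringOf.comp`, with
the datum of `ψ` supplied rather than chosen). [cite: MochizukiSemiAnbd2006, Def. 2.2(i) p.23] -/
theorem Hom.IsGlobalCoveringOf.comp_explicit {φ : Hom 𝒢 ℋ} {ψ : Hom ℋ 𝒦} {B : ℋ.BObj} {A : 𝒦.BObj}
    (hφ : φ.IsGlobalCoveringOf B) [HasBinaryProducts 𝒦.BObj] (α : Over A ⥤ ℋ.BObj) [α.IsEquivalence]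
    (e : ψ.pullbackFunctor ≅ Over.star A ⋙ α) :
    (φ.comp ψ).IsGlobalCoveringOf (α.inv.obj B).left := by
  obtain ⟨instH, αφ, hαφ, ⟨eφ⟩⟩ := hφ
  letI := instH
  haveI := hαφ
  let G : Over B ⥤ Over (α.inv.obj B).left :=
    Over.post α.inv ⋙ ((α.inv.obj B).iteratedSliceEquiv).functor
  refine ⟨inferInstance, G.inv ⋙ αφ, inferInstance, ⟨?_⟩⟩
  exact Hom.compPullbackIso φ ψ ≪≫ Functor.isoWhiskerRight e _ ≪≫ Functor.isoWhiskerLeft _ eφ ≪≫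
    Functor.isoWhiskerRight (starEquivStarIso A α B) αφ

section StarIso

variable {C : Type*} [Category C] [HasBinaryProducts C]

/-- `(X × −)` and `(X' × −)` for isomorphic `X ≅ X'` differ by the equivalence `Over.map i.hom` of the
over categories — by uniqueness of right adjoints (`forget ⊣ star`), the left adjoints
`map i⁻¹ ⋙ forget X` and `forget X'` being equal. [cite: MochizukiSemiAnbd2006, Def. 2.2(i) p.23] -/
noncomputable def starIsoStarCompMap {X X' : C} (i : X ≅ X') :
    Over.star X' ≅ Over.star X ⋙ (Over.mapIso i).functor :=
  conjugateIsoEquiv (Over.forgetAdjStar X')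
    ((Over.mapIso i).symm.toAdjunction.comp (Over.forgetAdjStar X)) (Iso.refl _)

end StarIso

/-- **The global clause is invariant under isomorphism of the base object**: if `χ : 𝒢 → 𝒦` satisfies
`B(𝒢) ≃ B(𝒦)_{/C}` compatibly with `χ^*` and `C ≅ C'`, then also `B(𝒢) ≃ B(𝒦)_{/C'}` compatibly with
`χ^*` (compose with `Over.map` of the isomorphism). [cite: MochizukiSemiAnbd2006, Def. 2.2(i) p.23] -/
theorem Hom.IsGlobalCoveringOf.of_iso {χ : Hom 𝒢 𝒦} {C C' : 𝒦.BObj} (h : χ.IsGlobalCoveringOf C)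
    (i : C ≅ C') : χ.IsGlobalCoveringOf C' := by
  obtain ⟨inst, α, hα, ⟨e⟩⟩ := h
  letI := inst
  haveI := hα
  refine ⟨inst, (Over.mapIso i.symm).functor ⋙ α, inferInstance, ⟨?_⟩⟩
  exact e ≪≫ Functor.isoWhiskerRight (starIsoStarCompMap i.symm) α

end SemiGraphOfAnabelioids

end Literature.AnabelianGeometry.SemiGraphs
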